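import Summits.Ventures.Crystal3D.Theorems.StickyWulffConstantTextureLiminfTexShadowLevelReachCoSlot
import Summits.Ventures.Crystal3D.Theorems.StickyWulffConstantCoaxialWallLawBarlowOneFccExport
import HarnessLib

/-!
# The CUT hexagon class of a clamped BARLOW plate: the co-slot census with lane F's plate discharges (sources, core rigidity, sealing, top exclusion)
# (lane T, crux `TextureLiminfV5`, stmt-Ventures-23912, registered stub `stub_terraceCensus`; (β)-lite × cut census — the Barlow glue of HOME/wall-p1-g22/BETA-CUT-g22.md §5(2))

HONEST FRAMING. Venture `Summits/Ventures/Crystal3D` (cell `crystal3d-full`), route `route-Ventures-StickyWulffConstant`, helper `--supports` the law-v5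
crux `TextureLiminfV5` (stmt-Ventures-23912), lane T.  Census-free, certificate-free; `KissingGap δ`, `KissingClassification δ` BY NAME as in lane F's
'…BarlowOneFccExport' (the template of this file); nothing about energies; F-C1 not moved.

THE POINT.  `coSlot_endPairs_plates` (…LevelReachCoSlot p743752) for an ACTUAL clamped Barlow bottom plate `stacking L₁ s₁ σ₁` (any Hägg word), base frame
`Fr ∈ {L₁, basalMirror ≫ L₁}`, ONE hexagon root `r` (`r 2 = 0`, rising under `Fr`) CUT AT EVERYTHING it can cross (`C μ :↔ ⟪r, μ⟫ = √(2/3)`, the canonical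
cut-everything predicate — `hC` by `id`, `hCall` by `inner_map_map`), and a clamped Barlow TOP plate `stacking L₂ s₂ σ₂` (ANY Hägg word) neither of whose two
dozens is the root dozen (`hne₁`, `hne₂` — the word-related / residual-class pairs): lane F's discharges VERBATIM — sources `hPsrc_of_plateCore_frame/_mirror`,
core rigidity `hstd_of_plateCore`, sealing `sealing_below/above_barlow`, and the ROOT-FRAME top exclusion `hPexcl0_root_of_receivingBarlowPlate` — at the
shifted constants `(R₀+1, ρ−1)`.  **`coSlot_barlow_endPairs`**: the raw source count of the class (admissible core-band balls crossing into the window) is at most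
`#T + #CUT + 220·(#rim_top + #rim_bot)`, `CUT` = `Fr`-readings of a plane crossed upward by `Fr r` inside the window reached by an `r`-line, `T` in `X × X` at
distance `1` in the window, two payers, witnessed by an admissible class of the plate system `⟨Fr, inPlaneRoots Fr 1⟩` with the predecessor clause and
`IsEndMove` — the input shape of `card_endPairs_le_of_localRow`.  This is the (β)-lite THREADING class made countable (memo §3): on a filling whose `r`-lines meet no
coherent cut plane `#CUT = 0` and the full hexagon budget applies.
WHAT THIS IS NOT: the flux lower bound for the source count (lane F's '…OneFccFluxC/F' pattern), the rim bounds, the certificate; F-C1 not moved.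
-/

noncomputable section

namespace Summit.Ventures.Crystal3D.Theorems

open Summit.Ventures.Crystal3D Finset
open Literature.MathematicalPhysics.StatisticalMechanics (barlowPos barlowStacking IsHaggSeq barlowPos_mem basalMirror)
open Summit.Ventures.Crystal3D.Cruxes.TextureLiminf.TexShadow (E3 stacking)
open scoped InnerProductSpace

open scoped Classical in
/-- **The cut hexagon class of a clamped Barlow plate: end pairs, typed export.**  See the module docstring. -/
theorem coSlot_barlow_endPairs (ver : WordVersion) {δ : ℝ} (hg : KissingGap δ) (hc : KissingClassification δ)
    {σ₁ σ₂ : ℤ → ℤ} (hσ₁ : IsHaggSeq σ₁) (hσ₂ : IsHaggSeq σ₂) (L₁ L₂ : E3 ≃ₗᵢ[ℝ] E3) (s₁ s₂ : E3)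
    (Fr : E3 ≃ₗᵢ[ℝ] E3) {t : ℤ} (hFr : (t = 1 ∧ Fr = L₁) ∨ (t = -1 ∧ Fr = basalMirror.trans L₁))
    {r : E3} (hr : r ∈ fccSlots) (hr2 : r 2 = 0) (hrup : 0 < (Fr r) 2)
    (hne₁ : (Fr : E3 → E3) '' ↑fccSlots ≠ (L₂ : E3 → E3) '' ↑fccSlots)
    (hne₂ : (Fr : E3 → E3) '' ↑fccSlots ≠ ((basalMirror.trans L₂ : E3 ≃ₗᵢ[ℝ] E3) : E3 → E3) '' ↑fccSlots)
    (X P₁ P₂ : Finset E3) (R₀ h ρ : ℝ) (hR₀ : 5 ≤ R₀) (hρ : R₀ + 2 ≤ ρ)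
    (hX : ∀ p ∈ X, ∀ q ∈ X, p ≠ q → 1 ≤ dist p q) (hP₁X : P₁ ⊆ X) (hP₂X : P₂ ⊆ X)
    (hP₁ : ∀ p, p ∈ P₁ ↔ (p ∈ stacking L₁ s₁ σ₁ ∧ -(2 * R₀) ≤ p 2 ∧ p 2 ≤ -R₀ ∧ p 0 ^ 2 + p 1 ^ 2 ≤ ρ ^ 2))
    (hP₂ : ∀ p, p ∈ P₂ ↔ (p ∈ stacking L₂ s₂ σ₂ ∧ h + R₀ ≤ p 2 ∧ p 2 ≤ h + 2 * R₀ ∧ p 0 ^ 2 + p 1 ^ 2 ≤ ρ ^ 2)) :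
    ∃ T : Finset (E3 × E3),
      ((P₁.filter fun p => -(R₀ + 1) - 1 - 1 ≤ p 2 ∧ p 2 ≤ -(R₀ + 1) - 1 ∧ p 0 ^ 2 + p 1 ^ 2 ≤ (ρ - 1 - 1) ^ 2).filter
          fun p => (∃ k i j : ℤ, p = L₁ (barlowPos 1 (Real.sqrt (2 / 3)) σ₁ k i j) + s₁ ∧ ¬ (σ₁ (k - 1) = -t ∧ σ₁ k = -t)) ∧
            -(R₀ + 1) - 1 < (p + Fr r) 2 ∧ (p + Fr r) 2 < h + (R₀ + 1) + 1).card ≤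
        T.card +
        (X.filter fun b => -(R₀ + 1) - 1 ≤ b 2 ∧ b 2 < h + (R₀ + 1) + 1 ∧
            (∃ μ, ⟪r, μ⟫_ℝ = Real.sqrt (2 / 3) ∧ IsTwinReading X Fr (Fr μ) b) ∧ b - Fr r ∈ X).card +
        220 * (X.filter fun s => h + (R₀ + 1) + 1 ≤ s 2 ∧ s 2 ≤ h + (R₀ + 1) + 1 + 1 ∧
            (ρ - 1 - 2) ^ 2 < s 0 ^ 2 + s 1 ^ 2).card +
        220 * (X.filter fun s => -(R₀ + 1) - 1 - 1 ≤ s 2 ∧ s 2 < -(R₀ + 1) - 1 ∧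
            (ρ - 1 - 1) ^ 2 < s 0 ^ 2 + s 1 ^ 2).card ∧
      (∀ bq ∈ T, bq.1 ∈ X ∧ bq.2 ∈ X ∧ dist bq.1 bq.2 = 1 ∧ -(R₀ + 1) - 1 ≤ bq.1 2 ∧ bq.1 2 < h + (R₀ + 1) + 1) ∧
      (∀ bq ∈ T, (X.filter fun q => dist bq.1 q = 1).card ≤ 11 ∨
        ∃ z₁ ∈ X, ∃ z₂ ∈ X, z₁ ≠ z₂ ∧ dist bq.1 z₁ = 1 ∧ dist bq.1 z₂ = 1 ∧
          (X.filter fun q => dist z₁ q = 1).card ≤ 11 ∧ (X.filter fun q => dist z₂ q = 1).card ≤ 11) ∧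
      (∀ bq ∈ T, ∃ r' ∈ inPlaneRoots Fr 1, ∃ κ : List E3, WFChain r' κ ∧
        bq.2 - (⟨Fr, inPlaneRoots Fr 1⟩ : PlateSystem).Fw κ (((-1 : ℝ) ^ κ.length) • r') ∈ X ∧
        IsEndMove X ver ((⟨Fr, inPlaneRoots Fr 1⟩ : PlateSystem).Fw κ)
          ((⟨Fr, inPlaneRoots Fr 1⟩ : PlateSystem).Fw κ (((-1 : ℝ) ^ κ.length) • r')) bq.2 bq.1) := by
  have hrRT : r ∈ inPlaneRoots Fr 1 := mem_filter.2 ⟨hr, hr2, by rw [one_mul]; exact hrup⟩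
  -- the word data over the base frame `Fr`, single root `r`
  set Fw : List E3 → (E3 ≃ₗᵢ[ℝ] E3) := fun κ => κ.foldr (fun μ G => ((ℝ ∙ μ)ᗮ.reflection).trans G) Fr with hFw
  set uw : List E3 → E3 := fun κ => κ.foldr (fun _ v => -v) r with huw
  set WFw : List E3 → Prop := fun κ =>
    List.rec (motive := fun _ => Prop) True (fun μ κ' ih => ih ∧ ‖μ‖ = 1 ∧
      (∀ w ∈ fccSlots, ⟪w, μ⟫_ℝ = 0 ∨ ⟪w, μ⟫_ℝ = Real.sqrt (2 / 3) ∨ ⟪w, μ⟫_ℝ = -Real.sqrt (2 / 3)) ∧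
      ⟪uw κ', μ⟫_ℝ = Real.sqrt (2 / 3) ∧ ∀ μ' κ'', κ' = μ' :: κ'' → μ' ≠ -μ) κ with hWFw
  set nextw : List E3 → E3 → List E3 :=
    fun κ m => @ite _ (∃ μ κ', κ = μ :: κ' ∧ (Fw κ).symm m = -μ) (Classical.propDecidable _) κ.tail
      ((Fw κ).symm m :: κ) with hnextw
  have hF0 : Fw [] = Fr := rfl
  have hFc : ∀ μ κ, Fw (μ :: κ) = ((ℝ ∙ μ)ᗮ.reflection).trans (Fw κ) := fun _ _ => rfl
  have hu0 : uw [] = r := rfl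
  have huc : ∀ μ κ, uw (μ :: κ) = -uw κ := fun _ _ => rfl
  have hWF0 : WFw [] := trivial
  have hWFc : ∀ μ κ, WFw (μ :: κ) ↔ (WFw κ ∧ ‖μ‖ = 1 ∧
      (∀ w ∈ fccSlots, ⟪w, μ⟫_ℝ = 0 ∨ ⟪w, μ⟫_ℝ = Real.sqrt (2 / 3) ∨ ⟪w, μ⟫_ℝ = -Real.sqrt (2 / 3)) ∧
      ⟪uw κ, μ⟫_ℝ = Real.sqrt (2 / 3) ∧ ∀ μ' κ', κ = μ' :: κ' → μ' ≠ -μ) := fun _ _ => Iff.rfl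
  have hnext_pop : ∀ μ κ' (m : E3), (Fw (μ :: κ')).symm m = -μ → nextw (μ :: κ') m = κ' := by
    intro μ κ' m hν
    simp only [hnextw]
    rw [if_pos ⟨μ, κ', rfl, hν⟩, List.tail_cons]
  have hnext_push : ∀ κ (m : E3), (∀ μ κ', κ = μ :: κ' → (Fw κ).symm m ≠ -μ) → nextw κ m = (Fw κ).symm m :: κ := by
    intro κ m hnp
    simp only [hnextw]
    rw [if_neg]
    rintro ⟨μ, κ', h, hν⟩
    exact hnp μ κ' h hν
  clear_value nextw WFw uw Fw
  have hu : ∀ κ, uw κ ∈ fccSlots := word_u_mem hr hu0 huc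
  -- the cell: clamps, core band, top band
  set W₁ : Set E3 := {x : E3 | -(2 * R₀) ≤ x 2 ∧ x 2 ≤ -R₀ ∧ x 0 ^ 2 + x 1 ^ 2 ≤ ρ ^ 2} with hW₁
  set W₂ : Set E3 := {x : E3 | h + R₀ ≤ x 2 ∧ x 2 ≤ h + 2 * R₀ ∧ x 0 ^ 2 + x 1 ^ 2 ≤ ρ ^ 2} with hW₂
  have hplate₁ : ∀ p ∈ stacking L₁ s₁ σ₁, p ∈ W₁ → p ∈ X := plate_mem_of_clamp₁ L₁ s₁ hP₁X hP₁
  have hplate₂ : ∀ p ∈ stacking L₂ s₂ σ₂, p ∈ W₂ → p ∈ X := plate_mem_of_clamp₂ L₂ s₂ hP₂X hP₂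
  set CORE := P₁.filter (fun p => -(R₀ + 1) - 1 - 1 ≤ p 2 ∧ p 2 ≤ -(R₀ + 1) - 1 ∧
    p 0 ^ 2 + p 1 ^ 2 ≤ (ρ - 1 - 1) ^ 2) with hCORE
  set TOP := P₂.filter (fun p => h + (R₀ + 1) + 1 ≤ p 2 ∧ p 2 ≤ h + (R₀ + 1) + 1 + 1 ∧
    p 0 ^ 2 + p 1 ^ 2 ≤ (ρ - 1 - 2) ^ 2) with hTOP
  have hcore : ∀ p ∈ CORE, ∃ k i j : ℤ, p = L₁ (barlowPos 1 (Real.sqrt (2 / 3)) σ₁ k i j) + s₁ ∧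
      ∀ x, dist p x ≤ 2 → x ∈ W₁ := coreBand₁_deep L₁ s₁ hP₁ hR₀ (by linarith)
  have htop : ∀ p ∈ TOP, ∃ k i j : ℤ, p = L₂ (barlowPos 1 (Real.sqrt (2 / 3)) σ₂ k i j) + s₂ ∧
      ∀ x, dist p x ≤ 2 → x ∈ W₂ := topBand₂_deep L₂ s₂ hP₂ hR₀ (by linarith)
  set srcOK : E3 → Prop := fun p =>
    ∃ k i j : ℤ, p = L₁ (barlowPos 1 (Real.sqrt (2 / 3)) σ₁ k i j) + s₁ ∧ ¬ (σ₁ (k - 1) = -t ∧ σ₁ k = -t) with hsrcOK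
  -- (1) sources (lane F), the trivial invariant clause dropped
  have hPsrc : ∀ p ∈ CORE, srcOK p → p ∈ X ∧
      (∃ a ∈ fccSlots, ∃ a' ∈ fccSlots, ∃ a'' ∈ fccSlots,
        ⟪a, a'⟫_ℝ = 1 / 2 ∧ ⟪a, a''⟫_ℝ = 1 / 2 ∧ ⟪a', a''⟫_ℝ = 1 / 2 ∧
        p + Fw [] a ∈ X ∧ p + Fw [] a' ∈ X ∧ p + Fw [] a'' ∈ X) ∧
      p - Fw [] (uw []) ∈ X ∧
      (IsFull X (Fw []) p ∨ (∃ m, IsTwinReading X (Fw []) m p ∧ ⟪Fw [] (uw []), m⟫_ℝ = 0) ∨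
        (ver = WordVersion.v2 ∧ IsNarrow X (Fw []) (Fw [] (uw [])) p)) := by
    have key : ∀ p ∈ CORE, srcOK p → p ∈ X ∧
        (∃ a ∈ fccSlots, ∃ a' ∈ fccSlots, ∃ a'' ∈ fccSlots,
          ⟪a, a'⟫_ℝ = 1 / 2 ∧ ⟪a, a''⟫_ℝ = 1 / 2 ∧ ⟪a', a''⟫_ℝ = 1 / 2 ∧
          p + Fw [] a ∈ X ∧ p + Fw [] a' ∈ X ∧ p + Fw [] a'' ∈ X) ∧
        p - Fw [] r ∈ X ∧
        (IsFull X (Fw []) p ∨ (∃ m, IsTwinReading X (Fw []) m p ∧ ⟪Fw [] r, m⟫_ℝ = 0) ∨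
          (ver = WordVersion.v2 ∧ IsNarrow X (Fw []) (Fw [] r) p)) ∧
        (fun (_ : E3 × List E3) => True) (p + Fw [] r, []) := by
      rcases hFr with ⟨ht, hFrL⟩ | ⟨ht, hFrL⟩
      · refine hPsrc_of_plateCore_frame hσ₁ L₁ s₁ hX hplate₁ ver hr hr2 CORE srcOK
          (P := fun _ => True) (by rw [hF0, hFrL]) ?_ (fun _ _ _ => trivial)
        intro p hp hok
        obtain ⟨k, i, j, hpk, hsg⟩ := hok
        obtain ⟨-, -, -, -, hball⟩ := hcore p hp
        refine ⟨k, i, j, hpk, hball, ?_⟩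
        rw [ht] at hsg; simpa using hsg
      · refine hPsrc_of_plateCore_mirror hσ₁ L₁ s₁ hX hplate₁ ver hr hr2 CORE srcOK
          (P := fun _ => True) (by rw [hF0, hFrL]) ?_ (fun _ _ _ => trivial)
        intro p hp hok
        obtain ⟨k, i, j, hpk, hsg⟩ := hok
        obtain ⟨-, -, -, -, hball⟩ := hcore p hp
        refine ⟨k, i, j, hpk, hball, ?_⟩
        rw [ht] at hsg; simpa using hsg
    intro p hp hok
    obtain ⟨h1, h2, h3, h4, -⟩ := key p hp hok
    rw [hu0]; exact ⟨h1, h2, h3, h4⟩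
  -- (2) core rigidity (lane F)
  have hstd : ∀ κ, WFw κ → ∀ p ∈ CORE, (∃ a ∈ fccSlots, ∃ a' ∈ fccSlots, ∃ a'' ∈ fccSlots,
        ⟪a, a'⟫_ℝ = 1 / 2 ∧ ⟪a, a''⟫_ℝ = 1 / 2 ∧ ⟪a', a''⟫_ℝ = 1 / 2 ∧
        p + Fw κ a ∈ X ∧ p + Fw κ a' ∈ X ∧ p + Fw κ a'' ∈ X) → Fw κ (uw κ) = Fw [] (uw []) := by
    intro κ hκ p hp hface
    rcases hFr with ⟨-, hFrL⟩ | ⟨-, hFrL⟩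
    · exact hstd_of_plateCore hσ₁ L₁ s₁ hX hplate₁ ⟨LinearIsometryEquiv.refl ℝ E3, inPlaneRoots Fr 1⟩
        PlateSystem.standardPair_refl hFc (by rw [hF0, hFrL]; rfl) hr2 hu0 huc hWFc CORE hcore κ hκ p hp hface
    · exact hstd_of_plateCore hσ₁ L₁ s₁ hX hplate₁ ⟨basalMirror, inPlaneRoots Fr 1⟩
        PlateSystem.standardPair_basalMirror hFc (by rw [hF0, hFrL]) hr2 hu0 huc hWFc CORE hcore κ hκ p hp hface
  -- (3) ROOT-FRAME top exclusion: the top plate's two dozens are not the root dozen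
  have hne₁' : ((Fw []) : E3 → E3) '' ↑fccSlots ≠ (L₂ : E3 → E3) '' ↑fccSlots := by rw [hF0]; exact hne₁
  have hne₂' : ((Fw []) : E3 → E3) '' ↑fccSlots ≠ ((basalMirror.trans L₂ : E3 ≃ₗᵢ[ℝ] E3) : E3 → E3) '' ↑fccSlots := by
    rw [hF0]; exact hne₂
  have hPexcl0root : ∀ b : E3, b ∈ TOP →
      (∃ a ∈ fccSlots, ∃ a' ∈ fccSlots, ∃ a'' ∈ fccSlots,
        ⟪a, a'⟫_ℝ = 1 / 2 ∧ ⟪a, a''⟫_ℝ = 1 / 2 ∧ ⟪a', a''⟫_ℝ = 1 / 2 ∧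
        b + Fw [] a ∈ X ∧ b + Fw [] a' ∈ X ∧ b + Fw [] a'' ∈ X) → False :=
    fun b hb hface => hPexcl0_root_of_receivingBarlowPlate hσ₂ L₂ s₂ hX hplate₂ (F := Fw) (WF := WFw) hne₁' hne₂' TOP htop
      (fun v => v.2 = []) (fun _ _ h => h) b [] hWF0 rfl hb hface
  -- (4) sealing (lane F)
  have hsealB := sealing_below_barlow L₁ s₁ hX hP₁X hP₁ (R₀ := R₀) (ρ := ρ) (by linarith) (by linarith)
  have hP₂seal := sealing_above_barlow L₂ s₂ hX hP₂X hP₂ (R₀ := R₀) (h := h) (ρ := ρ) (by linarith) (by linarith)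
  -- (5) the cut-everything predicate and the census
  have hup : 0 < (Fw [] (uw [])) 2 := by rw [hF0, hu0]; exact hrup
  have hP'top : ∀ p ∈ CORE, p 2 ≤ -(R₀ + 1) - 1 := fun p hp => (mem_filter.1 hp).2.2.1
  have hC : ∀ μ : E3, ⟪r, μ⟫_ℝ = Real.sqrt (2 / 3) → ⟪uw [], μ⟫_ℝ = Real.sqrt (2 / 3) := fun μ h => by rw [hu0]; exact h
  have hCall : ∀ m, IsMenuNormal (Fw []) m → ⟪Fw [] (uw []), m⟫_ℝ = Real.sqrt (2 / 3) → ⟪r, (Fw []).symm m⟫_ℝ = Real.sqrt (2 / 3) := by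
    intro m _ hdm
    rw [← LinearIsometryEquiv.inner_map_map (Fw []), LinearIsometryEquiv.apply_symm_apply, ← hu0]; exact hdm
  obtain ⟨T, hkey, hTpair, hTpay, hTpred, hTwit⟩ := coSlot_endPairs_plates ver (F := Fw) (u := uw) (WF := WFw) (next := nextw)
    hg hc hX hFc hu huc hWF0 hWFc hnext_pop hnext_push (fun μ => ⟪r, μ⟫_ℝ = Real.sqrt (2 / 3)) hC hCall hPexcl0root hup
    (by linarith : (3 : ℝ) ≤ R₀ + 1) (by linarith : R₀ + 1 ≤ ρ - 1) srcOK hP'top hPsrc hstd hsealB hP₂seal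
  rw [hF0, hu0] at hkey
  simp only [hsrcOK] at hkey
  -- (6) the witnesses in the plate-system form
  set S : PlateSystem := ⟨Fr, inPlaneRoots Fr 1⟩ with hS
  have hFwS : ∀ κ, Fw κ = S.Fw κ := by
    intro κ
    induction κ with
    | nil => rw [hF0]; rfl
    | cons μ κ ih => rw [hFc, ih]; rfl
  refine ⟨T, hkey, hTpair, hTpay, ?_⟩
  intro bq hbq
  obtain ⟨κ, hκ, hpred, hmove⟩ := hTwit bq hbq
  have hWF : WFChain r κ := wfChain_of_wf hu0 huc hWFc κ hκ
  have huκ : uw κ = ((-1 : ℝ) ^ κ.length) • r := word_u_eq_pow_root hu0 huc κ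
  rw [huκ, hFwS] at hpred hmove
  exact ⟨r, hrRT, κ, hWF, hpred, hmove⟩

end Summit.Ventures.Crystal3D.Theorems

end
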